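import Literature.NumberTheory.Automorphic.RootDataReducedOfDatum
import Literature.NumberTheory.Automorphic.RootSubgroupAssembly
import HarnessLib

/-!
# Reducedness of the root datum: the assembly after the conjugacy theorems

Trunk T-AUTOMORPHIC (G25 AutomorphicL); continuation of `RootDataReducedOfDatum.lean` (namespace
`Literature.NumberTheory.Automorphic`), devoted to the named fact `isReduced_of_isRootDatumOf` of
`RootData.lean` (Springer, *Linear Algebraic Groups*, 2nd ed., 7.4.3–7.4.4: *the root system
`R(G, T)` of a connected reductive group relative to a maximal torus is reduced*). That file
proved `isReduced_of_isRootDatumOf_of_facts`: the fact follows from Springer 7.6.4 (i)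
(`isConnectedReductive_centralizer_torus`) and the two semisimple-rank-one facts
`atMostTwo_isBorelIn_of_central` (7.1.4, 6.4.12) and `exists_rootHom_sup_isBorelIn_of_central`
(7.3.3 (ii)). Meanwhile the conjugacy of Borel subgroups (6.2.7 (iii), `isBorelIn_conj_holds`,
`BorelConjugacy.lean`) and of maximal tori of connected solvable groups (6.3.5 (iii),
`isMaximalTorusIn_conj_of_isSolvable_holds`, `SolvableGroupTori.lean`) are theorems, and
`RootSubgroupAssembly.lean` derives `atMostTwo_isBorelIn_of_central` from Springer 6.4.8 (ii)
alone (`centralizer_le_of_isBorelIn`: `Z_G(T) ⊆ B` for every Borel subgroup `B ⊇ T`;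
`atMostTwo_isBorelIn_of_central_of_centralizer_le`). This file records the resulting state of
the reduction for the root datum:

* `roots_isReduced_of_facts₃`, **`isReduced_of_isRootDatumOf_of_facts₃`** — Springer 7.4.4
  (`roots_isReduced`) and `isReduced_of_isRootDatumOf` follow from **7.6.4 (i)**
  (`isConnectedReductive_centralizer_torus`), **6.4.8 (ii)** (`centralizer_le_of_isBorelIn`) and
  **7.3.3 (ii)** (`exists_rootHom_sup_isBorelIn_of_central`) — the same three remaining leaves as
  `rootSubgroup_unique` (`rootSubgroup_unique_of_facts₃`);
* `isReduced_of_isRootDatumOf_of_facts₂'` — the variant through 7.6.4 (ii)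
  (`centralizer_eq_of_isMaximalTorusIn`, which implies 6.4.8 (ii) for reductive `G`) with the two
  conjugacy inputs of `atMostTwo_isBorelIn_of_central_of_facts` discharged.

All proofs are one-line compositions; no new facts.

## References

* [SpringerLAG1998] T. A. Springer, *Linear Algebraic Groups*, 2nd ed., Progress in Mathematics
  9, Birkhäuser (1998): 6.2.7 (iii), 6.3.5 (iii), 6.4.8 (ii), 6.4.12, 7.1.4, 7.3.3 (ii),
  7.4.3–7.4.4, 7.6.4.
-/

open scoped IsMulCommutative MatrixGroups

namespace Literature.NumberTheory.Automorphic

variable {k : Type*} [Field k] {n : Type*} [Fintype n] [DecidableEq n]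
variable {G T : Subgroup (GL n k)}

/-- **Springer 7.4.4 from 7.6.4 (i), 6.4.8 (ii) and 7.3.3 (ii)**: if `α` and `β` are roots of a
connected reductive group relative to a maximal torus over an algebraically closed field and
`α ^ a = β ^ b` with `a, b ≠ 0`, then `a = ±b` (`roots_isReduced`), granted
`isConnectedReductive_centralizer_torus` (7.6.4 (i)), `centralizer_le_of_isBorelIn` (6.4.8 (ii))
and `exists_rootHom_sup_isBorelIn_of_central` (7.3.3 (ii)); via `roots_isReduced_of_facts` and
`atMostTwo_isBorelIn_of_central_of_centralizer_le`. [cite: SpringerLAG1998, 7.4.4] -/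
theorem roots_isReduced_of_facts₃
    (hA : isConnectedReductive_centralizer_torus (k := k) (n := n))
    (hF : centralizer_le_of_isBorelIn (k := k) (n := n))
    (hC₂ : exists_rootHom_sup_isBorelIn_of_central (k := k) (n := n)) :
    roots_isReduced (G := G) (T := T) :=
  roots_isReduced_of_facts hA (atMostTwo_isBorelIn_of_central_of_centralizer_le hF) hC₂

variable {ι X Y : Type*} [AddCommGroup X] [AddCommGroup Y] [IsMulCommutative ↥T]

/-- **`isReduced_of_isRootDatumOf` from 7.6.4 (i), 6.4.8 (ii) and 7.3.3 (ii)** (Springer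
7.4.3–7.4.4: the root datum of a connected reductive group relative to a maximal torus over an
algebraically closed field is reduced): the named fact of `RootData.lean` follows from
`isConnectedReductive_centralizer_torus`, `centralizer_le_of_isBorelIn` and
`exists_rootHom_sup_isBorelIn_of_central`, the conjugacy theorems 6.2.7 (iii) and 6.3.5 (iii)
being proved. The conclusion is typed literally as the named fact.
[cite: SpringerLAG1998, 7.4.3–7.4.4] -/
theorem isReduced_of_isRootDatumOf_of_facts₃
    (hA : isConnectedReductive_centralizer_torus (k := k) (n := n))
    (hF : centralizer_le_of_isBorelIn (k := k) (n := n))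
    (hC₂ : exists_rootHom_sup_isBorelIn_of_central (k := k) (n := n)) :
    isReduced_of_isRootDatumOf (G := G) (T := T) (ι := ι) (X := X) (Y := Y) :=
  isReduced_of_isRootDatumOf_of_facts hA (atMostTwo_isBorelIn_of_central_of_centralizer_le hF) hC₂

/-- The variant through **7.6.4 (ii)** (`centralizer_eq_of_isMaximalTorusIn`, `Z_G(T) = T` for
reductive `G`) with the two conjugacy inputs of `atMostTwo_isBorelIn_of_central_of_facts`
discharged by `isBorelIn_conj_holds` and `isMaximalTorusIn_conj_of_isSolvable_holds`.
[cite: SpringerLAG1998, 7.4.3–7.4.4] -/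
theorem isReduced_of_isRootDatumOf_of_facts₂'
    (hA : isConnectedReductive_centralizer_torus (k := k) (n := n))
    (hF₃ : centralizer_eq_of_isMaximalTorusIn (k := k) (n := n))
    (hC₂ : exists_rootHom_sup_isBorelIn_of_central (k := k) (n := n)) :
    isReduced_of_isRootDatumOf (G := G) (T := T) (ι := ι) (X := X) (Y := Y) :=
  isReduced_of_isRootDatumOf_of_facts hA
    (atMostTwo_isBorelIn_of_central_of_facts isBorelIn_conj_holds
      isMaximalTorusIn_conj_of_isSolvable_holds hF₃) hC₂

end Literature.NumberTheory.Automorphic
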